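import Mathlib
import Summits.CriticalPhenomena.SAWScalingLimit.Theorems.ObservableToSLE.Negative.NoCutPoint

/-!
# Silence of the hypothesis `HexObservableLimit` of crux `ObservableToSLE` (stmt-CriticalPhenomena-10472)

Negative lemmas (refuter, cdisprove gen 2; obstructions W1/W2 typed).  The flat-at-`b` premise (H2)
of `HexObservableLimit` forces the boundary of the Dobrushin domain near `b = D.pt 1` to be a
horizontal segment with the domain above (`segment_subset_frontier_of_flat`); it FAILS on the unit
disc for every radius (`flat_premise_false_on_unitDisc`), so the hypothesis constrains nothing there
while the conclusion quantifies over the disc; and the slit disc `𝔻 ∖ [0, 1)` — prototype of the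
martingale's own domains `Ω ∖ γ[0, t]` — is the carrier of no Dobrushin domain
(`slitDisc_ne_carrier`, from `carrier_ne_of_cutPoint`).
-/

noncomputable section

open Literature.Probability.RandomPlanarGeometry MeasureTheory Filter Topology Set

namespace Summit.CriticalPhenomena.SAWScalingLimit.Theorems.ObservableToSLE.Negative

/-- FLATNESS FORCES A STRAIGHT BOTTOM: under the flat-at-`b` premise (H2) of `HexObservableLimit`
with radius `ρ`, the horizontal segment `{b + r : |r| < ρ}` lies on the frontier of the domain. [folklore] -/
theorem segment_subset_frontier_of_flat (D : DobrushinDomain) {ρ : ℝ}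
    (hflat : D.carrier ∩ Metric.ball (D.pt 1) ρ = {z : ℂ | (D.pt 1).im < z.im} ∩ Metric.ball (D.pt 1) ρ)
    {r : ℝ} (hr : |r| < ρ) : D.pt 1 + r ∈ frontier D.carrier := by
  rw [frontier_eq_closure_inter_closure, Set.mem_inter_iff]
  constructor
  · have ht : Tendsto (fun t : ℝ => D.pt 1 + r + t * Complex.I) (𝓝[>] 0) (𝓝 (D.pt 1 + r)) := by
      have : Tendsto (fun t : ℝ => D.pt 1 + r + t * Complex.I) (𝓝 0)
          (𝓝 (D.pt 1 + r + ((0 : ℝ) : ℂ) * Complex.I)) :=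
        ((continuous_const.add (Complex.continuous_ofReal.mul continuous_const)).tendsto 0)
      simpa using this.mono_left nhdsWithin_le_nhds
    refine mem_closure_of_tendsto ht ?_
    have hgap : 0 < ρ - |r| := by linarith
    have hsmall : ∀ᶠ t : ℝ in 𝓝[>] 0, t < ρ - |r| :=
      (nhdsWithin_le_nhds (s := Set.Ioi (0 : ℝ))) (Iio_mem_nhds hgap)
    filter_upwards [self_mem_nhdsWithin, hsmall] with t (ht0 : 0 < t) ht1
    have hmem : D.pt 1 + r + t * Complex.I ∈ {z : ℂ | (D.pt 1).im < z.im} ∩ Metric.ball (D.pt 1) ρ := by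
      constructor
      · show (D.pt 1).im < (D.pt 1 + r + t * Complex.I).im
        simp [ht0]
      · rw [Metric.mem_ball, dist_eq_norm]
        have : D.pt 1 + ↑r + ↑t * Complex.I - D.pt 1 = r + t * Complex.I := by ring
        rw [this]
        calc ‖(r : ℂ) + t * Complex.I‖ ≤ ‖(r : ℂ)‖ + ‖(t : ℂ) * Complex.I‖ := norm_add_le _ _
          _ = |r| + t := by simp [abs_of_pos ht0]
          _ < ρ := by linarith
    rw [← hflat] at hmem
    exact hmem.1
  · apply subset_closure
    intro hmem
    have hball : D.pt 1 + (r : ℂ) ∈ Metric.ball (D.pt 1) ρ := by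
      rw [Metric.mem_ball, dist_eq_norm]
      simpa using hr
    have : D.pt 1 + (r : ℂ) ∈ {z : ℂ | (D.pt 1).im < z.im} ∩ Metric.ball (D.pt 1) ρ := by
      rw [← hflat]; exact ⟨hmem, hball⟩
    have h2 := this.1
    simp at h2

/-- SILENCE ON THE DISC (W2 typed): the flat-at-`b` premise of `HexObservableLimit` FAILS for the
unit disc and every `ρ > 0` (witness `-1 + i·min(ρ,1)/2`). [folklore] -/
theorem flat_premise_false_on_unitDisc (ρ : ℝ) (hρ : 0 < ρ) :
    DobrushinDomain.unitDisc.carrier ∩ Metric.ball (DobrushinDomain.unitDisc.pt 1) ρ ≠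
      {z : ℂ | (DobrushinDomain.unitDisc.pt 1).im < z.im} ∩
        Metric.ball (DobrushinDomain.unitDisc.pt 1) ρ := by
  have hpt : DobrushinDomain.unitDisc.pt 1 = -1 := by
    change circleMap 0 1 (2 * Real.pi * ((![0, 1 / 2] : Fin 2 → ℝ) 1)) = -1
    have : (2 * Real.pi * ((![0, 1 / 2] : Fin 2 → ℝ) 1)) = Real.pi := by simp; ring
    rw [this]
    simp [circleMap, Complex.exp_pi_mul_I]
  rw [hpt]
  intro h
  set t : ℝ := min (ρ / 2) (1 / 2) with htdef
  have ht0 : 0 < t := lt_min (by linarith) (by norm_num)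
  have htρ : t < ρ := (min_le_left _ _).trans_lt (by linarith)
  have hz : (-1 : ℂ) + t * Complex.I ∈ {z : ℂ | (-1 : ℂ).im < z.im} ∩ Metric.ball (-1 : ℂ) ρ := by
    constructor
    · show (-1 : ℂ).im < ((-1 : ℂ) + t * Complex.I).im
      simp [ht0]
    · rw [Metric.mem_ball, dist_eq_norm]
      simp [abs_of_pos ht0, htρ]
  rw [← h] at hz
  have hdisc : ‖(-1 : ℂ) + t * Complex.I‖ < 1 := by
    simpa [DobrushinDomain.unitDisc] using hz.1
  have hre := Complex.abs_re_le_norm ((-1 : ℂ) + t * Complex.I)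
  simp at hre
  linarith

/-! ### The slit disc -/

/-- The slit disc `𝔻 ∖ [0, ∞)·` is open. [folklore] -/
theorem isOpen_slitDisc :
    IsOpen (Metric.ball (0 : ℂ) 1 \ {z : ℂ | z.im = 0 ∧ 0 ≤ z.re}) :=
  Metric.isOpen_ball.sdiff ((isClosed_eq Complex.continuous_im continuous_const).inter
    (isClosed_le continuous_const Complex.continuous_re))

/-- Points of the frontier of the slit disc lie on the unit circle or on the slit. [folklore] -/
theorem frontier_slitDisc_subset {z : ℂ}
    (hz : z ∈ frontier (Metric.ball (0 : ℂ) 1 \ {z : ℂ | z.im = 0 ∧ 0 ≤ z.re})) :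
    ‖z‖ = 1 ∨ (z.im = 0 ∧ 0 ≤ z.re) := by
  rw [isOpen_slitDisc.frontier_eq] at hz
  obtain ⟨hcl, hnot⟩ := hz
  have hle : ‖z‖ ≤ 1 := by
    have : z ∈ closure (Metric.ball (0 : ℂ) 1) := closure_mono sdiff_subset hcl
    rw [closure_ball (0 : ℂ) one_ne_zero, Metric.mem_closedBall, dist_zero_right] at this
    exact this
  rcases hle.lt_or_eq with hlt | heq
  · right
    by_contra hS
    exact hnot ⟨by rwa [Metric.mem_ball, dist_zero_right], hS⟩
  · exact Or.inl heq

/-- A real point `x ∈ [0, 1)` of the slit lies on the frontier of the slit disc. [folklore] -/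
theorem real_mem_frontier_slitDisc {x : ℝ} (hx0 : 0 ≤ x) (hx1 : x < 1) :
    (x : ℂ) ∈ frontier (Metric.ball (0 : ℂ) 1 \ {z : ℂ | z.im = 0 ∧ 0 ≤ z.re}) := by
  rw [isOpen_slitDisc.frontier_eq]
  refine ⟨?_, fun h => h.2 ⟨by simp, by simpa using hx0⟩⟩
  have ht : Tendsto (fun t : ℝ => (x : ℂ) + t * Complex.I) (𝓝[>] 0) (𝓝 (x : ℂ)) := by
    have : Tendsto (fun t : ℝ => (x : ℂ) + t * Complex.I) (𝓝 0) (𝓝 ((x : ℂ) + ((0 : ℝ) : ℂ) * Complex.I)) :=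
      ((continuous_const.add (Complex.continuous_ofReal.mul continuous_const)).tendsto 0)
    simpa using this.mono_left nhdsWithin_le_nhds
  refine mem_closure_of_tendsto ht ?_
  have hgap : 0 < 1 - x ^ 2 := by nlinarith
  obtain ⟨η, hη0, hη⟩ : ∃ η : ℝ, 0 < η ∧ η ^ 2 < 1 - x ^ 2 := by
    refine ⟨min (1 / 2) ((1 - x ^ 2) / 2), lt_min (by norm_num) (by linarith), ?_⟩
    have hm1 : min (1 / 2 : ℝ) ((1 - x ^ 2) / 2) ≤ 1 / 2 := min_le_left _ _
    have hm2 : min (1 / 2 : ℝ) ((1 - x ^ 2) / 2) ≤ (1 - x ^ 2) / 2 := min_le_right _ _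
    have hm0 : 0 < min (1 / 2 : ℝ) ((1 - x ^ 2) / 2) := lt_min (by norm_num) (by linarith)
    nlinarith
  have hsmall : ∀ᶠ t : ℝ in 𝓝[>] 0, t < η :=
    (nhdsWithin_le_nhds (s := Set.Ioi (0 : ℝ))) (Iio_mem_nhds hη0)
  filter_upwards [self_mem_nhdsWithin, hsmall] with t (ht0 : 0 < t) htη
  refine ⟨?_, fun h => ?_⟩
  · rw [Metric.mem_ball, dist_zero_right, Complex.norm_add_mul_I]
    rw [show (1 : ℝ) = Real.sqrt 1 by simp]
    apply Real.sqrt_lt_sqrt (by positivity)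
    nlinarith
  · have := h.1
    simp at this
    exact absurd this ht0.ne'

/-- The point `-1` of the circle lies on the frontier of the slit disc. [folklore] -/
theorem neg_one_mem_frontier_slitDisc :
    (-1 : ℂ) ∈ frontier (Metric.ball (0 : ℂ) 1 \ {z : ℂ | z.im = 0 ∧ 0 ≤ z.re}) := by
  rw [isOpen_slitDisc.frontier_eq]
  refine ⟨?_, fun h => by simpa using h.1⟩
  have ht : Tendsto (fun t : ℝ => ((t - 1 : ℝ) : ℂ)) (𝓝[>] 0) (𝓝 (-1 : ℂ)) := by
    have : Tendsto (fun t : ℝ => ((t - 1 : ℝ) : ℂ)) (𝓝 0) (𝓝 (((0 : ℝ) - 1 : ℝ) : ℂ)) :=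
      (Complex.continuous_ofReal.comp (continuous_id.sub continuous_const)).tendsto 0
    simpa using this.mono_left nhdsWithin_le_nhds
  refine mem_closure_of_tendsto ht ?_
  have hsmall : ∀ᶠ t : ℝ in 𝓝[>] 0, t < 1 :=
    (nhdsWithin_le_nhds (s := Set.Ioi (0 : ℝ))) (Iio_mem_nhds one_pos)
  filter_upwards [self_mem_nhdsWithin, hsmall] with t (ht0 : 0 < t) ht1
  refine ⟨?_, fun h => ?_⟩
  · rw [Metric.mem_ball, dist_zero_right, Complex.norm_real, Real.norm_eq_abs, abs_lt]
    constructor <;> linarith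
  · have := h.2
    simp at this
    linarith

/-- THE SLIT DISC'S FRONTIER HAS A CUT POINT: removing `1/2` disconnects it. [folklore] -/
theorem not_isPreconnected_frontier_slitDisc_diff :
    ¬ IsPreconnected (frontier (Metric.ball (0 : ℂ) 1 \ {z : ℂ | z.im = 0 ∧ 0 ≤ z.re}) \
      {((1 / 2 : ℝ) : ℂ)}) := by
  intro h
  set F := frontier (Metric.ball (0 : ℂ) 1 \ {z : ℂ | z.im = 0 ∧ 0 ≤ z.re}) \ {((1 / 2 : ℝ) : ℂ)}
  let O₁ : Set ℂ := Metric.ball 0 (3 / 4) ∩ {z : ℂ | z.re < 1 / 2}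
  let O₂ : Set ℂ := {z : ℂ | 1 / 2 < z.re} ∪ {z : ℂ | 3 / 4 < ‖z‖}
  have hO₁ : IsOpen O₁ := Metric.isOpen_ball.inter (isOpen_lt Complex.continuous_re continuous_const)
  have hO₂ : IsOpen O₂ :=
    (isOpen_lt continuous_const Complex.continuous_re).union (isOpen_lt continuous_const continuous_norm)
  have hcover : F ⊆ O₁ ∪ O₂ := by
    rintro z ⟨hz, hne⟩
    rcases frontier_slitDisc_subset hz with hn | ⟨him, hre⟩
    · exact Or.inr (Or.inr (show (3 / 4 : ℝ) < ‖z‖ by rw [hn]; norm_num))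
    · have hzre : z = ((z.re : ℝ) : ℂ) := Complex.ext (by simp) (by simp [him])
      rcases lt_trichotomy z.re (1 / 2) with hlt | heq | hgt
      · left
        refine ⟨?_, hlt⟩
        rw [Metric.mem_ball, dist_zero_right, hzre, Complex.norm_real, Real.norm_eq_abs, abs_lt]
        constructor <;> linarith
      · have hz12 : z = ((1 / 2 : ℝ) : ℂ) := Complex.ext (by simp [heq]) (by simp [him])
        exact absurd (Set.mem_singleton_iff.2 hz12) hne
      · exact Or.inr (Or.inl hgt)
  have h1 : (F ∩ O₁).Nonempty := by
    refine ⟨((1 / 4 : ℝ) : ℂ), ⟨real_mem_frontier_slitDisc (by norm_num) (by norm_num), ?_⟩, ?_, ?_⟩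
    · intro heq
      have := congrArg Complex.re (Set.mem_singleton_iff.1 heq)
      norm_num at this
    · rw [Metric.mem_ball, dist_zero_right, Complex.norm_real]; norm_num
    · show ((1 / 4 : ℝ) : ℂ).re < 1 / 2
      norm_num
  have h2 : (F ∩ O₂).Nonempty := by
    refine ⟨-1, ⟨neg_one_mem_frontier_slitDisc, ?_⟩, Or.inr ?_⟩
    · intro heq
      have := congrArg Complex.re (Set.mem_singleton_iff.1 heq)
      norm_num at this
    · show (3 / 4 : ℝ) < ‖(-1 : ℂ)‖
      norm_num
  obtain ⟨z, -, ⟨hz1, hz1'⟩, hz2⟩ := h O₁ O₂ hO₁ hO₂ hcover h1 h2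
  have hz1' : z.re < 1 / 2 := hz1'
  rw [Metric.mem_ball, dist_zero_right] at hz1
  rcases hz2 with hz2 | hz2
  · have hz2 : 1 / 2 < z.re := hz2
    linarith
  · have hz2 : 3 / 4 < ‖z‖ := hz2
    linarith

/-- W1 TYPED (instance): the slit disc `𝔻 ∖ [0, 1)` is the carrier of NO `DobrushinDomain`, so
`HexObservableLimit` (quantified `∀ D : DobrushinDomain`) says nothing about it — nor about any
slit domain `Ω ∖ γ[0, t]` of the martingale-observable scheme (`carrier_ne_of_cutPoint`). [folklore] -/
theorem slitDisc_ne_carrier (D : DobrushinDomain) :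
    D.carrier ≠ Metric.ball (0 : ℂ) 1 \ {z : ℂ | z.im = 0 ∧ 0 ≤ z.re} :=
  carrier_ne_of_cutPoint D (real_mem_frontier_slitDisc (by norm_num) (by norm_num))
    not_isPreconnected_frontier_slitDisc_diff

end Summit.CriticalPhenomena.SAWScalingLimit.Theorems.ObservableToSLE.Negative
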